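import Mathlib
import HarnessLib
import Summits.Parity.GeneralizedHardyLittlewood.Theorems.LeeYangFibresAbsoluteUpgradeModGammaDefs
import Literature.NumberTheory.Sieve.EulerMascheroniEin
import Literature.Analysis.Complex.CauchyTaylorBall

/-!
# Route `LeeYangFibres`, crux `AbsoluteUpgrade` (stmt-Parity-14116), line `dip-margin-rate-exchange`:
# Watson asymptotics of the regularised adjoint (`mg_adjointAsymp : MGEin → MGAdjointAsymp`)

Adjoint method for the registered stub `stub_modGammaDisc` (vocabulary and statements in
`LeeYangFibresAbsoluteUpgradeModGammaDefs`). This file proves the registered stub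
`mg_adjointAsymp : MGEin → MGAdjointAsymp`: for `N ≥ 1` there are `C, v₀ > 0` with
`|v g̃_z(v) − e^{γz} v^{−z}| ≤ (C/v) |v^{−z}|` for all `v ≥ v₀` and `|z| ≤ N − 1`
(`g̃_z = adjTilde N z`, the `Γ`-normalised, `N`-th order regularised adjoint).

Proof (elementary given `MGEin`: `einC` entire, real on `ℝ`, `|Ein x| ≤ |x|e^{|x|}`), with `N = n + 1`:
* the `k = 0` term of `adjTilde` is the main term: `p_0(z) = φ_z(0) = e^{−z Ein 0} = 1` (`mgAsymp_pCoeff_zero`)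
  and `v · v^{−(z+1)} = v^{−z}` (`mgAsymp_ofReal_mul_adjTilde_sub`);
* the `k ≥ 1` terms: Cauchy's estimate (`Literature.Analysis.Complex.norm_iteratedDeriv_le_of_forall_mem_ball`
  on the ball of radius `4`, sup bound `M_n = exp(n · 4e^4)` from `MGEin`) gives `|p_k(z)| ≤ M_n`, and
  `|(z+1)⋯(z+k)| ≤ (2n+1)^n`, `|v · v^{−(z+k+1)}| = |v^{−z}| v^{−k} ≤ |v^{−z}|/v` (`mgAsymp_norm_term_le`);
* the remainder: `|R_{n+1}(z, x)| ≤ C_n e^{n x}` for all real `x > 0` — near `0` by the Cauchy–Taylor bound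
  `Literature.Analysis.Complex.norm_sub_taylor_le_of_forall_mem_ball`, for `x ≥ 1` from `|φ_z(x)| ≤ e^{|z| x}`
  (tree: `0 ≤ Ein x ≤ x`, `Literature.NumberTheory.Sieve.ein_le_self`) — so the remainder integral is at most
  `C_n Γ(Re z + n + 2) (v − n)^{−(Re z + n + 2)} = O(|v^{−z}|/v²)` (Euler's integral
  `Real.integral_rpow_mul_exp_neg_mul_Ioi`; `Γ ≤ max(Γ 2, Γ(2n+2))` on `[2, 2n+2]` by convexity), while
  `1/Γ(1+z)` is bounded on the disc (it is entire, `Complex.differentiable_one_div_Gamma`).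

Constants are crude (`v₀ = 2N`, `C` exponential in `N`); only uniformity in `z` on the disc matters downstream.
References: Greaves 2001 §4.2 (adjoint functions of sieve delay equations) [Greaves2001]; Watson's lemma (folklore).
-/

noncomputable section

namespace Summit.Parity.GeneralizedHardyLittlewood.Cruxes.AbsoluteUpgrade.DipMarginRateExchange

open scoped BigOperators
open MeasureTheory Set
open Literature.NumberTheory.Sieve (ein)

/-! ## The `k = 0` coefficient -/

/-- `p_0(z) = φ_z(0) = exp(−z · Ein 0) = 1` (the `k = 0` term of `adjTilde` is the main term). -/
theorem mgAsymp_pCoeff_zero (z : ℂ) : pCoeff z 0 = 1 := by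
  simp [pCoeff, phiZ, einC]

/-! ## `φ_z` on the ball of radius `4` and on the positive reals (under `MGEin`) -/

/-- Cauchy data on the ball of radius `4`: `φ_z` is holomorphic there (it is entire, `einC` being entire)
and `|φ_z(x)| ≤ exp(|z| |x| e^{|x|}) ≤ M_n := exp(n · 4e^4)` for `|z| ≤ n`, `|x| < 4`. -/
theorem mgAsymp_phiZ_ball (h : MGEin) {n : ℝ} {z : ℂ} (hz : ‖z‖ ≤ n) :
    DifferentiableOn ℂ (phiZ z) (Metric.ball 0 4) ∧
      ∀ x ∈ Metric.ball (0 : ℂ) 4, ‖phiZ z x‖ ≤ Real.exp (n * (4 * Real.exp 4)) := by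
  refine ⟨fun x _ => ?_, fun x hx => ?_⟩
  · have hd : Differentiable ℂ (fun x => Complex.exp (-(z * einC x))) := ((h.1.const_mul z).neg).cexp
    exact (hd x).differentiableWithinAt
  · rw [Metric.mem_ball, dist_zero_right] at hx
    unfold phiZ
    refine (Complex.norm_exp_le_exp_norm _).trans ?_
    rw [Real.exp_le_exp, norm_neg, norm_mul]
    have h1 : ‖einC x‖ ≤ 4 * Real.exp 4 :=
      (h.2.2 x).trans (mul_le_mul hx.le (Real.exp_le_exp.mpr hx.le) (by positivity) (by norm_num))
    exact mul_le_mul hz h1 (by positivity) ((norm_nonneg _).trans hz)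

/-- Cauchy's estimate for the Taylor coefficients: `|p_k(z)| ≤ M_n / 2^k ≤ M_n`,
`M_n = exp(n · 4e^4)` the sup of `|φ_z|` on the ball of radius `4`. -/
theorem mgAsymp_norm_pCoeff_le (h : MGEin) {n : ℝ} {z : ℂ} (hz : ‖z‖ ≤ n) (k : ℕ) :
    ‖pCoeff z k‖ ≤ Real.exp (n * (4 * Real.exp 4)) := by
  have hC := Literature.Analysis.Complex.norm_iteratedDeriv_le_of_forall_mem_ball (c := (0 : ℂ))
    (R := 4) (by norm_num) (mgAsymp_phiZ_ball h hz).1 (mgAsymp_phiZ_ball h hz).2 k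
  unfold pCoeff
  rw [norm_mul, norm_inv, Complex.norm_natCast]
  have hk : (0 : ℝ) < k.factorial := by exact_mod_cast Nat.factorial_pos k
  have hM0 : 0 ≤ Real.exp (n * (4 * Real.exp 4)) := (Real.exp_pos _).le
  calc (k.factorial : ℝ)⁻¹ * ‖iteratedDeriv k (phiZ z) 0‖
      ≤ (k.factorial : ℝ)⁻¹ * (k.factorial * Real.exp (n * (4 * Real.exp 4))) :=
        mul_le_mul_of_nonneg_left (hC.trans (div_le_self (by positivity)
          (one_le_pow₀ (by norm_num)))) (by positivity)
    _ = Real.exp (n * (4 * Real.exp 4)) := by field_simp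

/-- Cauchy–Taylor near `0`: `|R_N(z, x)| ≤ 2 M_n` for `0 < |x| ≤ 1`. -/
theorem mgAsymp_norm_remZ_le_of_norm_le_one (h : MGEin) {n : ℝ} {z : ℂ} (hz : ‖z‖ ≤ n) (N : ℕ)
    {x : ℂ} (hx : ‖x‖ ≤ 1) (hx0 : x ≠ 0) : ‖remZ N z x‖ ≤ 2 * Real.exp (n * (4 * Real.exp 4)) := by
  set M := Real.exp (n * (4 * Real.exp 4))
  have hT := Literature.Analysis.Complex.norm_sub_taylor_le_of_forall_mem_ball (c := (0 : ℂ))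
    (R := 4) (by norm_num) (mgAsymp_phiZ_ball h hz).1 (mgAsymp_phiZ_ball h hz).2 (z := x)
    (by rw [sub_zero]; linarith) N
  have hsum : ∑ k ∈ Finset.range N, pCoeff z k * x ^ k =
      ∑ k ∈ Finset.range N, ((k.factorial : ℂ))⁻¹ • (x - 0) ^ k • iteratedDeriv k (phiZ z) 0 := by
    refine Finset.sum_congr rfl (fun k _ => ?_)
    rw [sub_zero, smul_eq_mul, smul_eq_mul, pCoeff]
    ring
  have hM0 : 0 ≤ M := (Real.exp_pos _).le
  have hxN : 0 < ‖x‖ ^ N := pow_pos (norm_pos_iff.mpr hx0) N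
  unfold remZ
  rw [norm_div, norm_pow, hsum, div_le_iff₀ hxN]
  refine hT.trans ?_
  rw [sub_zero]
  have : (2 * ‖x‖ / 4) ^ N ≤ ‖x‖ ^ N := by
    apply pow_le_pow_left₀ (by positivity)
    linarith [norm_nonneg x]
  calc 2 * M * (2 * ‖x‖ / 4) ^ N ≤ 2 * M * ‖x‖ ^ N := by gcongr

/-- On the positive reals: `|φ_z(x)| ≤ exp(|z| x) ≤ exp(n x)` for `|z| ≤ n` (`0 ≤ Ein x ≤ x`, tree
`Literature.NumberTheory.Sieve.ein_le_self`). -/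
theorem mgAsymp_norm_phiZ_ofReal_le (h : MGEin) {n : ℝ} {z : ℂ} (hz : ‖z‖ ≤ n) {x : ℝ} (hx : 0 ≤ x) :
    ‖phiZ z x‖ ≤ Real.exp (n * x) := by
  unfold phiZ
  rw [h.2.1 x]
  refine (Complex.norm_exp_le_exp_norm _).trans ?_
  rw [Real.exp_le_exp, norm_neg, norm_mul, Complex.norm_real, Real.norm_eq_abs,
    abs_of_nonneg (Literature.NumberTheory.Sieve.ein_nonneg hx)]
  exact mul_le_mul hz (Literature.NumberTheory.Sieve.ein_le_self hx)
    (Literature.NumberTheory.Sieve.ein_nonneg hx) ((norm_nonneg _).trans hz)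

/-- Away from `0`: `|R_{n+1}(z, x)| ≤ (1 + (n+1) M_n) e^{n x}` for real `x ≥ 1`, `|z| ≤ n`. -/
theorem mgAsymp_norm_remZ_ofReal_le_of_one_le (h : MGEin) {n : ℕ} {z : ℂ} (hz : ‖z‖ ≤ n) {x : ℝ}
    (hx : 1 ≤ x) :
    ‖remZ (n + 1) z x‖ ≤ (1 + (n + 1) * Real.exp (n * (4 * Real.exp 4))) * Real.exp (n * x) := by
  set M := Real.exp (n * (4 * Real.exp 4))
  have hx0 : 0 < x := by linarith
  have hM0 : 0 ≤ M := (Real.exp_pos _).le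
  have h1 : ‖phiZ z x‖ ≤ Real.exp (n * x) := mgAsymp_norm_phiZ_ofReal_le h hz hx0.le
  have h2 : ‖∑ k ∈ Finset.range (n + 1), pCoeff z k * (x : ℂ) ^ k‖ ≤ (n + 1) * M * x ^ n := by
    refine (norm_sum_le _ _).trans ?_
    have : ∀ k ∈ Finset.range (n + 1), ‖pCoeff z k * (x : ℂ) ^ k‖ ≤ M * x ^ n := by
      intro k hk
      rw [norm_mul, norm_pow, Complex.norm_real, Real.norm_of_nonneg hx0.le]
      have hk' : k ≤ n := Nat.lt_succ_iff.mp (Finset.mem_range.mp hk)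
      exact mul_le_mul (mgAsymp_norm_pCoeff_le h hz k) (pow_le_pow_right₀ hx hk') (by positivity) hM0
    refine (Finset.sum_le_sum this).trans ?_
    rw [Finset.sum_const, Finset.card_range, nsmul_eq_mul]
    exact le_of_eq (by push_cast; ring)
  unfold remZ
  rw [norm_div, norm_pow, Complex.norm_real, Real.norm_of_nonneg hx0.le]
  have hxn : (1 : ℝ) ≤ x ^ n := one_le_pow₀ hx
  have hxn1 : x ^ (n + 1) = x ^ n * x := pow_succ x n
  have hxN : (0 : ℝ) < x ^ (n + 1) := by positivity
  calc ‖phiZ z x - ∑ k ∈ Finset.range (n + 1), pCoeff z k * (x : ℂ) ^ k‖ / x ^ (n + 1)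
      ≤ (‖phiZ z x‖ + ‖∑ k ∈ Finset.range (n + 1), pCoeff z k * (x : ℂ) ^ k‖) / x ^ (n + 1) := by
        gcongr
        exact norm_sub_le _ _
    _ ≤ (Real.exp (n * x) + (n + 1) * M * x ^ n) / x ^ (n + 1) := by gcongr
    _ = Real.exp (n * x) / x ^ (n + 1) + (n + 1) * M / x := by
        rw [add_div, hxn1]
        field_simp
    _ ≤ Real.exp (n * x) + (n + 1) * M := by
        gcongr
        · exact div_le_self (Real.exp_pos _).le (one_le_pow₀ hx)
        · exact div_le_self (by positivity) hx
    _ ≤ (1 + (n + 1) * M) * Real.exp (n * x) := by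
        have : 1 ≤ Real.exp (n * x) := Real.one_le_exp (by positivity)
        have hA : (0 : ℝ) ≤ (n + 1) * M := by positivity
        nlinarith [mul_le_mul_of_nonneg_left this hA]

/-- Uniform remainder bound on `(0, ∞)`: `|R_{n+1}(z, x)| ≤ C_n e^{n x}` for `|z| ≤ n`. -/
theorem mgAsymp_norm_remZ_ofReal_le (h : MGEin) {n : ℕ} {z : ℂ} (hz : ‖z‖ ≤ n) {x : ℝ} (hx : 0 < x) :
    ‖remZ (n + 1) z x‖ ≤
      (2 * Real.exp (n * (4 * Real.exp 4)) + 1 + (n + 1) * Real.exp (n * (4 * Real.exp 4))) *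
        Real.exp (n * x) := by
  have hM0 : 0 ≤ Real.exp (n * (4 * Real.exp 4)) := (Real.exp_pos _).le
  have hnM : 0 ≤ (n : ℝ) * Real.exp (n * (4 * Real.exp 4)) := by positivity
  have h1 : 1 ≤ Real.exp (n * x) := Real.one_le_exp (by positivity)
  have hC0 : (0 : ℝ) ≤
      2 * Real.exp (n * (4 * Real.exp 4)) + 1 + (n + 1) * Real.exp (n * (4 * Real.exp 4)) := by
    positivity
  have hCE := mul_le_mul_of_nonneg_left h1 hC0
  rcases le_or_gt x 1 with hx1 | hx1
  · have := mgAsymp_norm_remZ_le_of_norm_le_one h hz (n + 1) (x := (x : ℂ))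
      (by rwa [Complex.norm_real, Real.norm_of_nonneg hx.le]) (Complex.ofReal_ne_zero.mpr hx.ne')
    nlinarith [this, hCE, hnM, hM0]
  · have := mgAsymp_norm_remZ_ofReal_le_of_one_le h hz hx1.le
    have h2 : 0 ≤ 2 * Real.exp (n * (4 * Real.exp 4)) * Real.exp (n * x) := by positivity
    nlinarith [this, h2]

/-! ## The remainder integral -/

/-- `‖∫_0^∞ e^{-vx} x^{z+n+1} R_{n+1}(z,x) dx‖ ≤ C_n Γ(Re z + n + 2) (v − n)^{−(Re z + n + 2)}`
for `v > n`, `|z| ≤ n`. -/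
theorem mgAsymp_norm_remIntegral_le (h : MGEin) {n : ℕ} {z : ℂ} (hz : ‖z‖ ≤ n) {v : ℝ} (hv : (n : ℝ) < v) :
    ‖∫ x in Ioi (0 : ℝ), Complex.exp (-((v : ℂ) * x)) * ((x : ℂ) ^ (z + ((n + 1 : ℕ) : ℂ))) *
        remZ (n + 1) z (x : ℂ)‖ ≤
      (2 * Real.exp (n * (4 * Real.exp 4)) + 1 + (n + 1) * Real.exp (n * (4 * Real.exp 4))) *
        ((1 / (v - n)) ^ (z.re + n + 2) * Real.Gamma (z.re + n + 2)) := by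
  set CR := 2 * Real.exp (n * (4 * Real.exp 4)) + 1 + (n + 1) * Real.exp (n * (4 * Real.exp 4))
  have hzre : |z.re| ≤ n := (Complex.abs_re_le_norm z).trans hz
  have hzre' := abs_le.mp hzre
  have ha : 0 < z.re + n + 2 := by linarith
  have hr : 0 < v - n := by linarith
  have hint : IntegrableOn (fun x : ℝ => x ^ (z.re + n + 2 - 1) * Real.exp (-((v - n) * x)))
      (Ioi 0) := by
    have := integrableOn_rpow_mul_exp_neg_mul_rpow (s := z.re + n + 2 - 1) (p := 1) (b := v - n)
      (by linarith) le_rfl hr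
    refine this.congr_fun (fun x _ => ?_) measurableSet_Ioi
    simp only [Real.rpow_one, neg_mul]
  rw [← Real.integral_rpow_mul_exp_neg_mul_Ioi ha hr, ← integral_const_mul]
  refine norm_integral_le_of_norm_le (hint.const_mul _) ?_
  refine (ae_restrict_iff' measurableSet_Ioi).mpr (ae_of_all _ (fun x (hx : 0 < x) => ?_))
  rw [norm_mul, norm_mul, Complex.norm_exp, Complex.norm_cpow_eq_rpow_re_of_pos hx]
  have hre1 : (-((v : ℂ) * (x : ℂ))).re = -(v * x) := by simp [Complex.mul_re]
  have hre2 : (z + ((n + 1 : ℕ) : ℂ)).re = z.re + n + 2 - 1 := by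
    simp only [Complex.add_re, Complex.natCast_re]
    push_cast
    ring
  rw [hre1, hre2]
  calc Real.exp (-(v * x)) * x ^ (z.re + n + 2 - 1) * ‖remZ (n + 1) z x‖
      ≤ Real.exp (-(v * x)) * x ^ (z.re + n + 2 - 1) * (CR * Real.exp (n * x)) := by
        gcongr
        exact mgAsymp_norm_remZ_ofReal_le h hz hx
    _ = CR * (x ^ (z.re + n + 2 - 1) * Real.exp (-((v - n) * x))) := by
        have : Real.exp (-((v - n) * x)) = Real.exp (-(v * x)) * Real.exp (n * x) := by
          rw [← Real.exp_add]; ring_nf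
        rw [this]; ring

/-- `Γ` is bounded on `[2, 2n+2]` (convexity). -/
theorem mgAsymp_Gamma_le_of_mem_Icc {n : ℕ} {a : ℝ} (ha : a ∈ Icc (2 : ℝ) (2 * n + 2)) :
    Real.Gamma a ≤ max (Real.Gamma 2) (Real.Gamma (2 * n + 2)) :=
  Real.convexOn_Gamma.le_max_of_mem_Icc (by norm_num : (2 : ℝ) ∈ Ioi 0)
    (by simp only [mem_Ioi]; positivity) ha

/-- `1/Γ(1+z)` is bounded on every disc (it is entire). -/
theorem mgAsymp_exists_norm_Gamma_inv_le (r : ℝ) :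
    ∃ C : ℝ, 0 ≤ C ∧ ∀ z : ℂ, ‖z‖ ≤ r → ‖(Complex.Gamma (1 + z))⁻¹‖ ≤ C := by
  have hc : Continuous fun z : ℂ => (Complex.Gamma (1 + z))⁻¹ :=
    Complex.differentiable_one_div_Gamma.continuous.comp (continuous_const.add continuous_id)
  obtain ⟨C, hC⟩ := (isCompact_closedBall (0 : ℂ) r).exists_bound_of_continuousOn hc.continuousOn
  refine ⟨max C 0, le_max_right _ _, fun z hz => (hC z (mem_closedBall_zero_iff.mpr hz)).trans
    (le_max_left _ _)⟩

/-! ## Algebra of the main term -/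

/-- `v · v^{−(z+k+1)} = v^{−z} · v^{−k}` for real `v > 0`. -/
theorem mgAsymp_ofReal_mul_cpow_neg_add {v : ℝ} (hv : 0 < v) (z : ℂ) (k : ℕ) :
    (v : ℂ) * (v : ℂ) ^ (-(z + ((k : ℂ) + 1))) = (v : ℂ) ^ (-z) * ((v : ℂ) ^ k)⁻¹ := by
  have hv0 : (v : ℂ) ≠ 0 := Complex.ofReal_ne_zero.mpr hv.ne'
  have hk : ((k : ℂ) + 1) = ((k + 1 : ℕ) : ℂ) := by push_cast; ring
  rw [neg_add, Complex.cpow_add _ _ hv0, Complex.cpow_neg _ ((k : ℂ) + 1), hk, Complex.cpow_natCast,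
    pow_succ]
  field_simp

/-- Auxiliary ring identity for `mgAsymp_ofReal_mul_adjTilde_sub`. -/
theorem mgAsymp_aux_ring (v E S c I m : ℂ) :
    v * (E * (S + c + I)) - E * m = E * (v * S + v * I) + (E * (v * c) - E * m) := by ring

/-- The decomposition `v g̃_z(v) − e^{γz} v^{−z} = e^{γz} [Σ_{1≤k≤n} (…) + v Γ(1+z)⁻¹ ∫ …]`
(the `k = 0` term is the main term since `p_0 = 1`). -/
theorem mgAsymp_ofReal_mul_adjTilde_sub {v : ℝ} (hv : 0 < v) (n : ℕ) (z : ℂ) :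
    (v : ℂ) * adjTilde (n + 1) z v -
        Complex.exp ((Real.eulerMascheroniConstant : ℂ) * z) * ((v : ℂ) ^ (-z)) =
      Complex.exp ((Real.eulerMascheroniConstant : ℂ) * z) *
        ((∑ k ∈ Finset.range n, (v : ℂ) *
            (pCoeff z (k + 1) * (∏ i ∈ Finset.range (k + 1), (z + ((i : ℂ) + 1))) *
              ((v : ℂ) ^ (-(z + (((k + 1 : ℕ) : ℂ) + 1)))))) +
          (v : ℂ) * ((Complex.Gamma (1 + z))⁻¹ *
            ∫ x in Ioi (0 : ℝ), Complex.exp (-((v : ℂ) * x)) * ((x : ℂ) ^ (z + ((n + 1 : ℕ) : ℂ))) *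
              remZ (n + 1) z (x : ℂ))) := by
  have h0 : (v : ℂ) * (v : ℂ) ^ (-(z + (((0 : ℕ) : ℂ) + 1))) = (v : ℂ) ^ (-z) := by
    rw [mgAsymp_ofReal_mul_cpow_neg_add hv z 0, pow_zero, inv_one, mul_one]
  unfold adjTilde
  rw [Finset.sum_range_succ' (fun k => pCoeff z k * (∏ i ∈ Finset.range k, (z + ((i : ℂ) + 1))) *
    ((v : ℂ) ^ (-(z + ((k : ℂ) + 1))))) n, mgAsymp_pCoeff_zero, Finset.prod_range_zero, one_mul, one_mul,
    mgAsymp_aux_ring, h0, sub_self, add_zero, Finset.mul_sum]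

/-- Norm of one `k ≥ 1` term: `≤ M_n (2n+1)^n |v^{−z}|/v` for `v ≥ 1`, `k + 1 ≤ n`. -/
theorem mgAsymp_norm_term_le (h : MGEin) {n : ℕ} {z : ℂ} (hz : ‖z‖ ≤ n) {v : ℝ} (hv : 1 ≤ v) {k : ℕ}
    (hk : k < n) :
    ‖(v : ℂ) * (pCoeff z (k + 1) * (∏ i ∈ Finset.range (k + 1), (z + ((i : ℂ) + 1))) *
        ((v : ℂ) ^ (-(z + (((k + 1 : ℕ) : ℂ) + 1)))))‖ ≤
      Real.exp (n * (4 * Real.exp 4)) * (2 * n + 1) ^ n * (‖(v : ℂ) ^ (-z)‖ / v) := by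
  set M := Real.exp (n * (4 * Real.exp 4))
  have hv0 : 0 < v := by linarith
  rw [show ∀ A B C : ℂ, (v : ℂ) * (A * B * C) = A * B * ((v : ℂ) * C) from fun A B C => by ring,
    mgAsymp_ofReal_mul_cpow_neg_add hv0 z (k + 1), norm_mul, norm_mul, norm_mul, norm_inv, norm_pow,
    Complex.norm_real, Real.norm_of_nonneg hv0.le]
  have hp : ‖pCoeff z (k + 1)‖ ≤ M := mgAsymp_norm_pCoeff_le h hz (k + 1)
  have hP : ‖∏ i ∈ Finset.range (k + 1), (z + ((i : ℂ) + 1))‖ ≤ (2 * n + 1) ^ n := by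
    rw [norm_prod]
    calc ∏ i ∈ Finset.range (k + 1), ‖z + ((i : ℂ) + 1)‖
        ≤ ∏ _i ∈ Finset.range (k + 1), (2 * (n : ℝ) + 1) := by
          refine Finset.prod_le_prod (fun i _ => norm_nonneg _) (fun i hi => ?_)
          have hi' : i < k + 1 := Finset.mem_range.mp hi
          have hi1 : ((i : ℂ) + 1) = ((i + 1 : ℕ) : ℂ) := by push_cast; ring
          have hin : (i : ℝ) + 1 ≤ n := by exact_mod_cast (by omega : i + 1 ≤ n)
          calc ‖z + ((i : ℂ) + 1)‖ ≤ ‖z‖ + ‖(i : ℂ) + 1‖ := norm_add_le _ _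
            _ = ‖z‖ + (i + 1) := by rw [hi1, Complex.norm_natCast]; push_cast; ring
            _ ≤ 2 * n + 1 := by linarith
      _ = (2 * n + 1) ^ (k + 1) := by rw [Finset.prod_const, Finset.card_range]
      _ ≤ (2 * n + 1) ^ n := pow_le_pow_right₀ (by linarith [n.cast_nonneg (α := ℝ)]) (by omega)
  have hvk : (v ^ (k + 1))⁻¹ ≤ 1 / v := by
    rw [one_div]
    exact inv_anti₀ hv0 (le_self_pow₀ hv (by omega))
  calc ‖pCoeff z (k + 1)‖ * ‖∏ i ∈ Finset.range (k + 1), (z + ((i : ℂ) + 1))‖ *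
        (‖(v : ℂ) ^ (-z)‖ * (v ^ (k + 1))⁻¹)
      ≤ M * (2 * n + 1) ^ n * (‖(v : ℂ) ^ (-z)‖ * (1 / v)) := by gcongr
    _ = M * (2 * n + 1) ^ n * (‖(v : ℂ) ^ (-z)‖ / v) := by ring

/-! ## The Watson asymptotics -/

/-- **Watson asymptotics of the regularised adjoint** (line `dip-margin-rate-exchange`, adjoint method):
`|v g̃_z(v) − e^{γz} v^{−z}| ≤ (C/v)|v^{−z}|` uniformly on `|z| ≤ N − 1`, `v ≥ v₀`. -/
theorem mg_adjointAsymp : MGEin → MGAdjointAsymp := by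
  intro h N hN
  obtain ⟨n, rfl⟩ : ∃ n, N = n + 1 := ⟨N - 1, by omega⟩
  set M : ℝ := Real.exp (n * (4 * Real.exp 4))
  set CR : ℝ := 2 * M + 1 + (n + 1) * M with hCR
  obtain ⟨CG, hCG0, hCG⟩ := mgAsymp_exists_norm_Gamma_inv_le (n : ℝ)
  set G : ℝ := max (Real.Gamma 2) (Real.Gamma (2 * n + 2))
  set E : ℝ := Real.exp (‖(Real.eulerMascheroniConstant : ℂ)‖ * n)
  have hM0 : 0 ≤ M := (Real.exp_pos _).le
  have hG0 : 0 ≤ G := (Real.Gamma_pos_of_pos two_pos).le.trans (le_max_left _ _)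
  have hE0 : 0 ≤ E := (Real.exp_pos _).le
  have hCR0 : 0 ≤ CR := by rw [hCR]; positivity
  refine ⟨E * (n * (M * (2 * n + 1) ^ n) + CG * CR * G * 2 ^ (2 * n + 2)), 2 * n + 2,
    by positivity, ?_⟩
  intro v hv z hz
  push_cast at hz
  have hn0 : (0 : ℝ) ≤ n := n.cast_nonneg
  have hz' : ‖z‖ ≤ n := by linarith
  have hv1 : 1 ≤ v := by linarith
  have hv0 : 0 < v := by linarith
  have hvn : (n : ℝ) < v := by linarith
  have hzre : |z.re| ≤ n := (Complex.abs_re_le_norm z).trans hz'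
  have hzre' := abs_le.mp hzre
  have hvz : ‖(v : ℂ) ^ (-z)‖ = v ^ (-z.re) := by
    rw [Complex.norm_cpow_eq_rpow_re_of_pos hv0]
    simp
  rw [mgAsymp_ofReal_mul_adjTilde_sub hv0 n z]
  have hEn : ‖Complex.exp ((Real.eulerMascheroniConstant : ℂ) * z)‖ ≤ E := by
    refine (Complex.norm_exp_le_exp_norm _).trans ?_
    rw [Real.exp_le_exp, norm_mul]
    exact mul_le_mul_of_nonneg_left hz' (norm_nonneg _)
  have hT : ‖∑ k ∈ Finset.range n, (v : ℂ) *
      (pCoeff z (k + 1) * (∏ i ∈ Finset.range (k + 1), (z + ((i : ℂ) + 1))) *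
        ((v : ℂ) ^ (-(z + (((k + 1 : ℕ) : ℂ) + 1)))))‖ ≤
      n * (M * (2 * n + 1) ^ n * (‖(v : ℂ) ^ (-z)‖ / v)) := by
    refine (norm_sum_le _ _).trans ?_
    refine (Finset.sum_le_sum (fun k hk => mgAsymp_norm_term_le h hz' hv1 (Finset.mem_range.mp hk))).trans ?_
    rw [Finset.sum_const, Finset.card_range, nsmul_eq_mul]
  have hI := mgAsymp_norm_remIntegral_le h hz' hvn
  have hGa : Real.Gamma (z.re + n + 2) ≤ G :=
    mgAsymp_Gamma_le_of_mem_Icc (n := n) ⟨by linarith, by linarith⟩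
  have hpow : (1 / (v - n)) ^ (z.re + n + 2) ≤ 2 ^ (2 * n + 2) * (‖(v : ℂ) ^ (-z)‖ / v ^ 2) := by
    rw [hvz]
    have h1 : 1 / (v - n) ≤ 2 / v := by
      rw [div_le_div_iff₀ (by linarith) hv0]; linarith
    have h2 : (1 / (v - n)) ^ (z.re + n + 2) ≤ (2 / v) ^ (z.re + n + 2) :=
      Real.rpow_le_rpow (by positivity) h1 (by linarith)
    refine h2.trans ?_
    rw [Real.div_rpow (by norm_num) hv0.le]
    have h3 : (2 : ℝ) ^ (z.re + n + 2) ≤ (2 : ℝ) ^ (((2 * n + 2 : ℕ) : ℝ)) :=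
      Real.rpow_le_rpow_of_exponent_le (by norm_num) (by push_cast; linarith)
    rw [Real.rpow_natCast] at h3
    have h4 : v ^ (z.re + n + 2) = v ^ z.re * v ^ ((n : ℝ) + 2) := by
      rw [add_assoc, Real.rpow_add hv0]
    have h5 : v ^ 2 ≤ v ^ ((n : ℝ) + 2) := by
      rw [show v ^ 2 = v ^ ((2 : ℕ) : ℝ) from (Real.rpow_natCast v 2).symm]
      exact Real.rpow_le_rpow_of_exponent_le hv1 (by push_cast; linarith)
    rw [Real.rpow_neg hv0.le, h4, div_eq_mul_inv,
      show (v ^ z.re)⁻¹ / v ^ 2 = (v ^ z.re * v ^ 2)⁻¹ by rw [mul_inv, div_eq_mul_inv]]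
    have h6 : (v ^ z.re * v ^ ((n : ℝ) + 2))⁻¹ ≤ (v ^ z.re * v ^ 2)⁻¹ :=
      inv_anti₀ (by positivity) (by gcongr)
    exact mul_le_mul h3 h6 (by positivity) (by positivity)
  have hI' : ‖∫ x in Ioi (0 : ℝ), Complex.exp (-((v : ℂ) * x)) * ((x : ℂ) ^ (z + ((n + 1 : ℕ) : ℂ))) *
        remZ (n + 1) z (x : ℂ)‖ ≤ CR * (2 ^ (2 * n + 2) * (‖(v : ℂ) ^ (-z)‖ / v ^ 2) * G) :=
    hI.trans (mul_le_mul_of_nonneg_left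
      (mul_le_mul hpow hGa (Real.Gamma_pos_of_pos (by linarith)).le (by positivity)) hCR0)
  calc _ ≤ E * (n * (M * (2 * n + 1) ^ n * (‖(v : ℂ) ^ (-z)‖ / v)) +
          v * (CG * (CR * (2 ^ (2 * n + 2) * (‖(v : ℂ) ^ (-z)‖ / v ^ 2) * G)))) := by
        rw [norm_mul]
        refine mul_le_mul hEn ?_ (norm_nonneg _) hE0
        refine (norm_add_le _ _).trans (add_le_add hT ?_)
        rw [norm_mul, norm_mul, Complex.norm_real, Real.norm_of_nonneg hv0.le]
        exact mul_le_mul_of_nonneg_left (mul_le_mul (hCG z hz') hI' (norm_nonneg _) hCG0) hv0.le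
    _ = E * (n * (M * (2 * n + 1) ^ n) + CG * CR * G * 2 ^ (2 * n + 2)) / v * ‖(v : ℂ) ^ (-z)‖ := by
        field_simp

end Summit.Parity.GeneralizedHardyLittlewood.Cruxes.AbsoluteUpgrade.DipMarginRateExchange

end
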